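import Summits.AtomisticToContinuum.FouriersLaw.Theses.CoercivePulse
import Summits.AtomisticToContinuum.FouriersLaw.Theorems.CoercivePulseLinearCeilingAbelMeanCeiling
import Summits.AtomisticToContinuum.FouriersLaw.Theorems.CoercivePulseLinearCeilingSpectralRepresentation
import Summits.AtomisticToContinuum.FouriersLaw.Theorems.CoercivePulseLinearCeilingHelfandMoment
import Summits.AtomisticToContinuum.FouriersLaw.Theorems.CoercivePulseLinearCeilingEnvelopeOfSpectralAbelBound
import HarnessLib

/-!
# `LinearCeiling` from the route's own (R) — the certificate of line `SpikeLemma`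
(crux `CoercivePulse.LinearCeiling`, item stmt-AtomisticToContinuum-15383; `--supports` file: it closes nothing, it REDUCES
the crux to the existing item stmt-AtomisticToContinuum-13416; line lead prover-line-stmt-AtomisticToContinuum-15383-0, 2026-08-17)

WHAT. `linearCeiling_of_uniformAbelianRegularity : UniformAbelianRegularity → LinearCeiling` (hypothesis = the route decl
`CoercivePulse.UniformAbelianRegularity`, item stmt-13416, shared verbatim with EmbeddedDrudeMourre / HoelderEscapeProfile /
StaticAbelianSqueeze / CageBudgetFekete and consumed by this route's `closes` through `AbelThermodynamicLimitGlueBy_holds`;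
conclusion = the crux decl, the DIFFUSIVE UPPER ENVELOPE OF THE HELFAND MOMENT). With this theorem the crux `LinearCeiling`
carries no mathematical content beyond (R): it closes the moment stmt-13416 closes (tenure planner: close-on-close, or
`route edit --split LinearCeiling --into UniformAbelianRegularity --glue-by` this theorem). It also records, for the whole
portfolio, that the POINTWISE-in-time linear envelope of `M(t)` is not a stronger obligation than Abel-boundedness of the
current autocorrelation (idea cards `subadditive-spike-collapse`, `abel-inversion-collapse` of this crux): the inversion
`2∫₀ᵗ(t−u)C_T(u)du ≤ 8t·Â(1/t)` is unconditional once `C_T` is a cosine transform.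

HOW (every ingredient is a landed stub of the line, namespace `…Theorems.LinearCeiling.SpikeLemma`). For a guarded pair
`(μ, D)` of `pinnedChain ω₂ lam β γ` at `T` (μ the shift- and reversal-invariant DLR state, `D` ANY `μ`-preserving dynamics
commuting a.e. with the shift) with `Σ_x (1+x²)|S(x,t)| < ∞` at every `t`:
(1) `stub_abelMeanCeiling`: (R) ⇒ `Â(ν) = ∫₀^∞ e^{−νt} C_T(t) dt ≤ B` for `ν ∈ (0, ν₀)` ((R) at ε = 1 and bath constant 1,
    fixed-frequency open/closed matching for the canonical Buttà–Marchioro twin, `abel_bound_of_regularity`);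
(2) `stub_spectralRepresentation`: `C_T(t) = ∫ cos(ωt) dσ(ω)` for a finite measure `σ` (cosine Bochner for the canonical pair +
    uniqueness of the shift-invariant DLR state + uniqueness of good orbits);
(3) `stub_envelopeOfSpectralAbelBound` (pure real analysis): (1) + (2) ⇒ `2∫₀ᵗ (t−u) C_T(u) du ≤ b·t` for all `t ≥ 0`;
(4) `stub_helfandMoment`: `M(t) − M(0) = 2∫₀ᵗ (t−u) C_T(u) du` for `t > 0` (per-site twice-integrated conservation law,
    cut-off weights and summation by parts, Tannery in `x`, dominated convergence in `u` through the window-uniform clustering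
    majorant of the canonical twin).
Hence `M(t) ≤ M(0) + b·t` for every `t ≥ 0`: the crux with `t₃ = 0`.
-/

noncomputable section

namespace Summit.AtomisticToContinuum.FouriersLaw.Theorems.LinearCeiling.SpikeLemma

open MeasureTheory Filter Set
open scoped Topology BigOperators

/-- **`LinearCeiling` is a consequence of the route's own (R).** For the pinned anharmonic chain, N-uniform Abelian regularity
of the open chain's equilibrium current autocorrelation (`CoercivePulse.UniformAbelianRegularity`, item
stmt-AtomisticToContinuum-13416) implies the diffusive upper envelope of the Helfand moment of the averaged equilibrium
energy pulse for every guarded pair (`CoercivePulse.LinearCeiling`, item stmt-AtomisticToContinuum-15383), with anchor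
`t₃ = 0`: `M(t) ≤ M(0) + b·t` for all `t ≥ 0`. Over landed theorems only (the four stubs of line `SpikeLemma`).
[cite: BonettoLebowitzReyBellet2000, §7] [cite: Helfand1960, §II] -/
theorem linearCeiling_of_uniformAbelianRegularity :
    _root_.Summit.AtomisticToContinuum.FouriersLaw.Theses.CoercivePulse.UniformAbelianRegularity → _root_.Summit.AtomisticToContinuum.FouriersLaw.Theses.CoercivePulse.LinearCeiling := by
  intro hR ω₂ lam β γ hω hl hβ T hT μ hG hSI hRv D hP hSh h hh S hS hSum
  obtain ⟨B, ν₀, hν₀, hA⟩ := stub_abelMeanCeiling hR ω₂ lam β γ hω hl hβ T hT μ hG hSI hRv D hP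
  obtain ⟨σ, hσ, hC⟩ := stub_spectralRepresentation ω₂ lam β γ hω hl hβ T hT μ hG hSI hRv D hP
  obtain ⟨b, hb⟩ := stub_envelopeOfSpectralAbelBound σ hσ _ hC B ν₀ hν₀ hA
  refine ⟨b, 0, fun t ht => ?_⟩
  rcases eq_or_lt_of_le ht with h0 | h0
  · subst h0
    simp
  · have hH := stub_helfandMoment ω₂ lam β γ hω hl hβ T hT μ hG hSI hRv D hP hSh h hh S hS hSum t h0
    have hbt := hb t ht
    rw [sub_zero]
    linarith

end Summit.AtomisticToContinuum.FouriersLaw.Theorems.LinearCeiling.SpikeLemma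

end
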